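/-
Copyright: derived here (Resolution Observatory cell `pub-rosobs`, carver gen 56). AI-written Lean; AI review is
weaker than expert review.  Companion file of the cell's POLYNOMIAL weighted-centre model `W(f)`: the pure-algebra
skeleton of engine 1's LEMMAS M^W / W² "quadratic rigidity" (THEOREM-L5N-eng1-g36 §12 W2–W4; CARVER-NOTES-eng1-g36
T45, by name).  Instrument — NOT a resolution theorem and NOT a statement about the invariant of
[AbramovichTemkinWlodarczyk2024].
-/
import Literature.AlgebraicGeometry.Resolution.WeightedCentreLinearRigidity
import Literature.AlgebraicGeometry.Resolution.WeightedCentreEulerReadings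
import Mathlib.LinearAlgebra.Basis.VectorSpace
import Mathlib.LinearAlgebra.Prod
import HarnessLib

/-!
# Quadratic rigidity skeleton: `(P)`-injectivity of `r ↦ D_r E` and linearity of the heavy shift data (T45)

INSTRUMENT, NOT a resolution theorem: the pure-algebra skeleton of LEMMA M^W and LEMMA W² (THEOREM-L5N
eng1-g36 §12 W2, W3) and of the sentence of §12 W4 "all three heavy shift data are `k`-linear functions
of `β` through `(P)`-injective maps", for ENGINE 1's polynomial weighted-centre TOY MODEL `W(f)`.

* `dirDerivLin E : (σ → K) →ₗ[K] K[X_σ]`, `r ↦ D_r E = Σ_k r_k • ∂_k E` — the differential map of a fixed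
  form `E` (the tree's `EulerReadings.dirDeriv`, bundled as a linear map in the direction).
* `exists_notMem_vars_of_dirDeriv_eq_zero` (**the dichotomy of W3 (1) / W2**, `K` a field of
  characteristic `p`, `E` homogeneous of degree `d < p`): a NON-ZERO kernel direction `r` (`D_r E = 0`)
  has a coordinate `w₀` with `r_{w₀} ≠ 0`, and after the class-linear change `A = lineSubst w₀ r`
  (`A e_{w₀} = r`; invertible, tree `lineSubst_bijective`) the variable `X_{w₀}` occurs in NO monomial of
  `E ∘ A` — "the slot `w₀` is unpinned, `(P)` fails".  (Tree lemma
  `LinearRigidity.notMem_vars_lineSubst_of_isHomogeneous'` plus the choice of `w₀`.)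
* `injective_dirDerivLin_of_pinned` (**T45 by name**): if every slot stays pinned under every such
  change (`hpin : ∀ w₀ r, r_{w₀} ≠ 0 → w₀ ∈ vars (E ∘ lineSubst w₀ r)` — the model's `(P)` for this
  class, a hypothesis here), then `r ↦ D_r E` is injective (`ker = ⊥`).  W3 (1) is the case `d = 4`
  (`E′` the Schur-complement quartic), W2 the case `d = 3` (`C = C_{MMM}`).
* `solution_unique`, `exists_linear_solution` (**W2 / W3 (2)**: "`γ` is the UNIQUE solution: a
  `k`-linear function of `β`"): for `K`-linear `D : V → F` injective and `Φ : B → F`, the equation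
  `D γ + Φ β = 0` has at most one solution `γ` for each `β`, and there is ONE `K`-linear `Γ : B → V` with
  `γ = Γ β` for every solution pair (a left inverse of `D`, Mathlib
  `LinearMap.exists_leftInverse_of_injective`).
* `exists_linear_solution_chain` (**W3, last sentence; W4**): if the second-stage equation is
  `D₂ γ₂ + Φ₂ (β, γ₁) = 0` with `D₂` injective and the first-stage datum is already linear, `γ₁ = Γ₁ β`,
  then `γ₂ = Γ₂ β` for one `K`-linear `Γ₂` ("`γ_W` is `k`-linear in `(β, γ_M^{[W]})`, so in `β`").
* `exists_linear_solution_dirDeriv` — the two halves combined in the shape of `(W³)₅` / `(M²W)₄`: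
  `D_γ E + Φ β = 0` with pins persistent ⇒ `γ = Γ β`.

The engine reads `(W³)₅` coefficientwise in the non-heavy monomials (the components `γ_w` are
polynomials in the OTHER variables while `E′`, `∂_w E′` involve only the `W`-variables), i.e. it applies
the scalar statements here once per non-heavy monomial; that separation is model-level and not typed.
Bookkeeping only (linear algebra over a field [Serre1973, Ch. IV §1]; differential operators on additive
forms [Hironaka1970AdditiveGroups]); NOT a statement about the Abramovich–Temkin–Włodarczyk invariant
[AbramovichTemkinWlodarczyk2024, §5.2]; nothing here is summit progress; AI-written, AI review weaker
than expert review.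
-/

namespace Literature.AlgebraicGeometry.Resolution.WeightedBlowup

namespace QuadraticRigidity

open MvPolynomial

/-! ## The differential map `r ↦ D_r E` as a linear map in the direction -/

section Differential

variable {K : Type*} [CommRing K] {σ : Type*} [Fintype σ]

/-- The differential map of a fixed polynomial `E`: `r ↦ D_r E = Σ_k r_k • ∂_k E`, `K`-linear in the
constant direction `r : σ → K` (the tree's `EulerReadings.dirDeriv r E`, bundled).
[cite: Hironaka1970AdditiveGroups, additive forms and differential operators] -/
noncomputable def dirDerivLin (E : MvPolynomial σ K) : (σ → K) →ₗ[K] MvPolynomial σ K where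
  toFun r := EulerReadings.dirDeriv r E
  map_add' r s := by
    simp only [EulerReadings.dirDeriv, Pi.add_apply, add_smul, Finset.sum_add_distrib]
  map_smul' c r := by
    simp only [EulerReadings.dirDeriv, Pi.smul_apply, smul_eq_mul, RingHom.id_apply,
      Finset.smul_sum, smul_smul]

/-- Unfolding: `dirDerivLin E r = Σ_k r_k • ∂_k E`.
[cite: Hironaka1970AdditiveGroups, additive forms and differential operators] -/
@[simp] theorem dirDerivLin_apply (E : MvPolynomial σ K) (r : σ → K) :
    dirDerivLin E r = ∑ k, r k • pderiv k E := rfl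

/-- `dirDerivLin E r` is the tree's directional derivative `EulerReadings.dirDeriv r E`.
[cite: Hironaka1970AdditiveGroups, additive forms and differential operators] -/
theorem dirDerivLin_eq_dirDeriv (E : MvPolynomial σ K) (r : σ → K) :
    dirDerivLin E r = EulerReadings.dirDeriv r E := rfl

end Differential

/-! ## `(P)`-injectivity: a kernel direction unpins a slot (W3 (1), W2; T45) -/

section Pinned

variable {K : Type*} [Field K] {σ : Type*} [DecidableEq σ] [Fintype σ]

/-- **The dichotomy behind W3 (1) and W2.**  `E` homogeneous of degree `d < p = char K` and `r ≠ 0` a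
kernel direction, `D_r E = Σ_k r_k • ∂_k E = 0` ⇒ some coordinate `w₀` has `r_{w₀} ≠ 0` and, after the
class-linear change `lineSubst w₀ r` (`e_{w₀} ↦ r`), the variable `X_{w₀}` occurs in no monomial of
`E ∘ lineSubst w₀ r` ("the slot `w₀` is unpinned; `(P)` fails").
[cite: Hironaka1970AdditiveGroups, additive forms and differential operators] -/
theorem exists_notMem_vars_of_dirDeriv_eq_zero (p : ℕ) [CharP K p] {E : MvPolynomial σ K} {d : ℕ}
    (hE : E.IsHomogeneous d) (hd : d < p) {r : σ → K} (hr : r ≠ 0)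
    (hD : ∑ k, r k • pderiv k E = 0) :
    ∃ w₀, r w₀ ≠ 0 ∧ w₀ ∉ (lineSubst w₀ r E).vars := by
  obtain ⟨w₀, hw₀⟩ := Function.ne_iff.mp hr
  exact ⟨w₀, hw₀, LinearRigidity.notMem_vars_lineSubst_of_isHomogeneous' p w₀ r hE hd hD⟩

/-- **T45 by name (W3 (1): `E′` quartic, `d = 4`; W2: `C` cubic, `d = 3`).**  If every slot stays pinned
under every class-linear change with `r_{w₀} ≠ 0` (hypothesis `hpin`, the model's `(P)` for this
class), then the only kernel direction of `E` is `r = 0`.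
[cite: Hironaka1970AdditiveGroups, additive forms and differential operators] -/
theorem dirDeriv_eq_zero_imp_eq_zero_of_pinned (p : ℕ) [CharP K p] {E : MvPolynomial σ K} {d : ℕ}
    (hE : E.IsHomogeneous d) (hd : d < p)
    (hpin : ∀ (w₀ : σ) (r : σ → K), r w₀ ≠ 0 → w₀ ∈ (lineSubst w₀ r E).vars)
    {r : σ → K} (hD : ∑ k, r k • pderiv k E = 0) : r = 0 := by
  by_contra hr
  obtain ⟨w₀, hw₀, hnot⟩ := exists_notMem_vars_of_dirDeriv_eq_zero p hE hd hr hD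
  exact hnot (hpin w₀ r hw₀)

/-- **T45 by name, injectivity form:** under persistence of pins the differential map
`r ↦ D_r E` is injective ("`r ↦ D_r E′` is injective, or `(P)` fails").
[cite: Hironaka1970AdditiveGroups, additive forms and differential operators] -/
theorem injective_dirDerivLin_of_pinned (p : ℕ) [CharP K p] {E : MvPolynomial σ K} {d : ℕ}
    (hE : E.IsHomogeneous d) (hd : d < p)
    (hpin : ∀ (w₀ : σ) (r : σ → K), r w₀ ≠ 0 → w₀ ∈ (lineSubst w₀ r E).vars) :
    Function.Injective (dirDerivLin E) := by
  rw [← LinearMap.ker_eq_bot, LinearMap.ker_eq_bot']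
  intro r hr
  exact dirDeriv_eq_zero_imp_eq_zero_of_pinned p hE hd hpin (by simpa using hr)

/-- The same as `ker = ⊥`.
[cite: Hironaka1970AdditiveGroups, additive forms and differential operators] -/
theorem ker_dirDerivLin_eq_bot_of_pinned (p : ℕ) [CharP K p] {E : MvPolynomial σ K} {d : ℕ}
    (hE : E.IsHomogeneous d) (hd : d < p)
    (hpin : ∀ (w₀ : σ) (r : σ → K), r w₀ ≠ 0 → w₀ ∈ (lineSubst w₀ r E).vars) :
    LinearMap.ker (dirDerivLin E) = ⊥ :=
  LinearMap.ker_eq_bot.mpr (injective_dirDerivLin_of_pinned p hE hd hpin)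

end Pinned

/-! ## Unique solution, linear in `β` (W2, W3 (2), W4) -/

section UniqueSolution

variable {K : Type*} [Field K]
  {V : Type*} [AddCommGroup V] [Module K V]
  {F : Type*} [AddCommGroup F] [Module K F]
  {B : Type*} [AddCommGroup B] [Module K B]

/-- **Uniqueness (W2 "`γ_M^{[W]}` is the UNIQUE solution"; W3 (2) for `γ_W`).**  With `D` injective the
equation `D γ + Φ β = 0` has at most one solution `γ` for each `β`.
[cite: Serre1973, Ch. IV §1 (linear algebra over a field)] -/
theorem solution_unique {D : V →ₗ[K] F} (hD : Function.Injective D) (Φ : B →ₗ[K] F) {β : B}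
    {γ₁ γ₂ : V} (h₁ : D γ₁ + Φ β = 0) (h₂ : D γ₂ + Φ β = 0) : γ₁ = γ₂ :=
  hD (by rw [eq_neg_of_add_eq_zero_left h₁, eq_neg_of_add_eq_zero_left h₂])

/-- **Linearity in `β` (W2 / W3 (2) / W4: "a `k`-linear function of `β` through a `(P)`-injective map").**
With `D` injective there is ONE `K`-linear `Γ : B → V` such that every solution pair of
`D γ + Φ β = 0` has `γ = Γ β` (`Γ = −g ∘ Φ` for a left inverse `g` of `D`).
[cite: Serre1973, Ch. IV §1 (linear algebra over a field)] -/
theorem exists_linear_solution {D : V →ₗ[K] F} (hD : Function.Injective D) (Φ : B →ₗ[K] F) :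
    ∃ Γ : B →ₗ[K] V, ∀ (β : B) (γ : V), D γ + Φ β = 0 → γ = Γ β := by
  obtain ⟨g, hg⟩ := LinearMap.exists_leftInverse_of_injective D (LinearMap.ker_eq_bot.mpr hD)
  refine ⟨-(g.comp Φ), fun β γ h => ?_⟩
  have hγ : g (D γ) = γ := by
    have := LinearMap.congr_fun hg γ
    simpa using this
  rw [LinearMap.neg_apply, LinearMap.comp_apply, ← map_neg, ← eq_neg_of_add_eq_zero_left h, hγ]

/-- The linear solution map is compatible with uniqueness: if `Γ` is as in `exists_linear_solution` and
`γ` solves the equation at `β`, then `γ = Γ β` (restated for citation).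
[cite: Serre1973, Ch. IV §1 (linear algebra over a field)] -/
theorem eq_of_linear_solution {D : V →ₗ[K] F} (Φ : B →ₗ[K] F) {Γ : B →ₗ[K] V}
    (hΓ : ∀ (β : B) (γ : V), D γ + Φ β = 0 → γ = Γ β) {β : B} {γ : V} (h : D γ + Φ β = 0) :
    γ = Γ β :=
  hΓ β γ h

/-- **Chaining (W3, last sentence; W4).**  Second stage `D₂ γ₂ + Φ₂ (β, γ₁) = 0` with `D₂` injective and
first-stage datum already linear, `γ₁ = Γ₁ β` ⇒ `γ₂ = Γ₂ β` for ONE `K`-linear `Γ₂ : B → V₂`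
("`γ_W` is a `k`-linear function of `(β, γ_M^{[W]})`, so of `β`").
[cite: Serre1973, Ch. IV §1 (linear algebra over a field)] -/
theorem exists_linear_solution_chain
    {V₁ : Type*} [AddCommGroup V₁] [Module K V₁]
    {V₂ : Type*} [AddCommGroup V₂] [Module K V₂]
    {F₂ : Type*} [AddCommGroup F₂] [Module K F₂]
    {D₂ : V₂ →ₗ[K] F₂} (hD₂ : Function.Injective D₂) (Φ₂ : (B × V₁) →ₗ[K] F₂) (Γ₁ : B →ₗ[K] V₁) :
    ∃ Γ₂ : B →ₗ[K] V₂, ∀ (β : B) (γ₂ : V₂), D₂ γ₂ + Φ₂ (β, Γ₁ β) = 0 → γ₂ = Γ₂ β := by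
  obtain ⟨Γ, hΓ⟩ := exists_linear_solution hD₂ Φ₂
  refine ⟨Γ.comp (LinearMap.id.prod Γ₁), fun β γ₂ h => ?_⟩
  have hβ : (LinearMap.id.prod Γ₁ : B →ₗ[K] B × V₁) β = (β, Γ₁ β) := rfl
  rw [LinearMap.comp_apply, hβ]
  exact hΓ (β, Γ₁ β) γ₂ h

end UniqueSolution

/-! ## The two halves combined in the shape of `(W³)₅` / `(M²W)₄` -/

section Combined

variable {K : Type*} [Field K] {σ : Type*} [DecidableEq σ] [Fintype σ]
  {B : Type*} [AddCommGroup B] [Module K B]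

/-- **W3 (2) / W2 as used:** `E` homogeneous of degree `d < p`, pins persistent (`hpin`), and the
reading `D_γ E + Φ β = 0` with `Φ` `K`-linear in the lower-order data `β` ⇒ there is ONE `K`-linear `Γ`
with `γ = Γ β` for every solution pair — "`γ` is the unique solution, a `k`-linear function of `β`".
[cite: Hironaka1970AdditiveGroups, additive forms and differential operators] -/
theorem exists_linear_solution_dirDeriv (p : ℕ) [CharP K p] {E : MvPolynomial σ K} {d : ℕ}
    (hE : E.IsHomogeneous d) (hd : d < p)
    (hpin : ∀ (w₀ : σ) (r : σ → K), r w₀ ≠ 0 → w₀ ∈ (lineSubst w₀ r E).vars)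
    (Φ : B →ₗ[K] MvPolynomial σ K) :
    ∃ Γ : B →ₗ[K] (σ → K), ∀ (β : B) (γ : σ → K),
      (∑ k, γ k • pderiv k E) + Φ β = 0 → γ = Γ β := by
  obtain ⟨Γ, hΓ⟩ := exists_linear_solution (injective_dirDerivLin_of_pinned p hE hd hpin) Φ
  exact ⟨Γ, fun β γ h => hΓ β γ (by simpa using h)⟩

/-- Uniqueness in the same shape: two solutions `γ₁, γ₂` of `D_γ E + Φ β = 0` at the same `β` coincide.
[cite: Hironaka1970AdditiveGroups, additive forms and differential operators] -/
theorem dirDeriv_solution_unique (p : ℕ) [CharP K p] {E : MvPolynomial σ K} {d : ℕ}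
    (hE : E.IsHomogeneous d) (hd : d < p)
    (hpin : ∀ (w₀ : σ) (r : σ → K), r w₀ ≠ 0 → w₀ ∈ (lineSubst w₀ r E).vars)
    (Φ : B →ₗ[K] MvPolynomial σ K) {β : B} {γ₁ γ₂ : σ → K}
    (h₁ : (∑ k, γ₁ k • pderiv k E) + Φ β = 0) (h₂ : (∑ k, γ₂ k • pderiv k E) + Φ β = 0) :
    γ₁ = γ₂ :=
  solution_unique (injective_dirDerivLin_of_pinned p hE hd hpin) Φ (by simpa using h₁)
    (by simpa using h₂)

/-- The degree hypotheses of W3 (1) (`d = 4`) and W2 (`d = 3`) hold for every `p ≥ 7` (and `p = 5`).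
[cite: AbramovichTemkinWlodarczyk2024, §5.2] -/
theorem degree_lt_of_seven_le {p : ℕ} (hp : 7 ≤ p) : 3 < p ∧ 4 < p := by omega

end Combined

end QuadraticRigidity

end Literature.AlgebraicGeometry.Resolution.WeightedBlowup
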